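import Summits.HodgeConjecture.CorCM.MumfordTateRankRigidModuloCentre
import Literature.AlgebraicGeometry.Motives.HodgeLieRigidDirectSum
import HarnessLib

/-!
# A `Θ`-rigid factor times ANY abelian variety without factors of type IV stays `Θ`-rigid: `H¹(A)` rigid, `B` no type IV ⟹ `H¹(A × B)` rigid
# (the central `Θ`-traces of `H¹(B)` vanish; `Motives/HodgeLieRigidDirectSum`)

COR-CM (cell `pub-hodgecm2`, seat `b27` gen 54, count-neutral Mumford–Tate-rank ladder; theorems only, no definition, no named fact; UNCONDITIONAL —
nothing here uses or asserts HC_CM).  `Motives/HodgeLieRigidDirectSum.rigid_of_rigid_of_center_eq_bot` on the Künneth bicone of `H¹(A × B)`: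
`Lie Hg(H¹B) ∩ End_Hdg(H¹B) = 0` for `B` without simple factors of type IV (`hodgeLie_hodge_one_inf_endAlg_eq_bot_of_hasNoTypeIVFactor`), so
every `Θ`-rigid `A` (Ribet pairs, imaginary-quadratic unbalanced `A`, no-type-IV `A`, …) gives a `Θ`-rigid `A × B`, again usable as a monotone factor.
* **`hodgeLie_rigid_prod_of_rigid_of_hasNoTypeIVFactor`** — `H¹(A)` `Θ`-rigid, `HasNoTypeIVFactor B` ⟹ `H¹(A × B)` `Θ`-rigid;
* **`mtRank_hodge_one_le_of_isIsogenous_rigid_prod_noTypeIV_prod`** — then `t(X) ≥ t(A × B)` for every `X ∼ (A × B) × Y`.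

## References
* [MoonenZarhin1999LowDim] B. Moonen, Yu. G. Zarhin, *Hodge classes on abelian varieties of low dimension*, Math. Ann. 315 (1999), §1, §3 (3.1)
  [corpus: paper:arxiv-math_9901113 pp. 2, 6]. [cite: MoonenZarhin1999LowDim, §3 (3.1)]
* [Deligne1982HodgeCycles] P. Deligne, LNM 900 (1982), I §3 Prop. 3.6. [cite: Deligne1982HodgeCycles, I §3 Prop. 3.6]
-/

noncomputable section

open scoped TensorProduct
open CategoryTheory CategoryTheory.Limits Module NumberField

namespace Summit.HodgeConjecture.CorCM

open Literature.AlgebraicGeometry.Motives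
open Literature.AlgebraicGeometry.Motives.AbelianVariety
open Literature.AlgebraicGeometry.Motives.HodgeStructure
open Literature.AlgebraicGeometry.HodgeTheory
open Literature.AlgebraicGeometry.ComplexMultiplication

variable [HodgeTensorFacts.{0, 0}] {X : AbelianVariety ℂ} {n : ℕ}

set_option maxHeartbeats 800000 in
/-- **`H¹(A)` `Θ`-rigid and `B` without factors of type IV ⟹ `H¹(A × B)` `Θ`-rigid.** [cite: MoonenZarhin1999LowDim, §3 (3.1)]
[cite: Deligne1982HodgeCycles, I §3 Prop. 3.6] -/
theorem hodgeLie_rigid_prod_of_rigid_of_hasNoTypeIVFactor {A B : AbelianVariety ℂ} {m m₁ : ℕ} (hP : IsSmoothProjective m (A.prod B).X)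
    (hT : IsSmoothProjective m₁ A.X)
    (hrigA : haveI := BettiUniverse.finite hT 1
      ∀ 𝔟 : Submodule ℚ (Module.End ℚ (bettiCohomology A.X 1)),
        𝔟 ≤ (BettiUniverse.hodge exists_isReal_hodgeModel_holds hT 1).hodgeLie →
        (∀ X' ∈ 𝔟, ∀ Y ∈ 𝔟, X' * Y - Y * X' ∈ 𝔟) →
        (∃ Θ ∈ Submodule.span ℂ ((fun X' : Module.End ℚ (bettiCohomology A.X 1) => X'.baseChange ℂ) ''
            (𝔟 : Set (Module.End ℚ (bettiCohomology A.X 1)))),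
          ∀ p, ∀ x ∈ (BettiUniverse.hodge exists_isReal_hodgeModel_holds hT 1).piece p (((1 : ℕ) : ℤ) - p),
            Θ x = ((2 * p - ((1 : ℕ) : ℤ) : ℤ) : ℂ) • x) →
        (BettiUniverse.hodge exists_isReal_hodgeModel_holds hT 1).hodgeLie ≤ 𝔟)
    (hB4 : HasNoTypeIVFactor B) :
    haveI := BettiUniverse.finite hP 1
    ∀ 𝔞 : Submodule ℚ (Module.End ℚ (bettiCohomology (A.prod B).X 1)),
      𝔞 ≤ (BettiUniverse.hodge exists_isReal_hodgeModel_holds hP 1).hodgeLie →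
      (∀ X' ∈ 𝔞, ∀ Y ∈ 𝔞, X' * Y - Y * X' ∈ 𝔞) →
      (∃ Θ ∈ Submodule.span ℂ ((fun X' : Module.End ℚ (bettiCohomology (A.prod B).X 1) => X'.baseChange ℂ) ''
          (𝔞 : Set (Module.End ℚ (bettiCohomology (A.prod B).X 1)))),
        ∀ p, ∀ x ∈ (BettiUniverse.hodge exists_isReal_hodgeModel_holds hP 1).piece p (((1 : ℕ) : ℤ) - p),
          Θ x = ((2 * p - ((1 : ℕ) : ℤ) : ℤ) : ℂ) • x) →
      (BettiUniverse.hodge exists_isReal_hodgeModel_holds hP 1).hodgeLie ≤ 𝔞 := by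
  classical
  have hnA : A.dim = m₁ := schemeDim_eq_holds hT
  subst hnA
  have hT' : IsSmoothProjective B.dim B.X := AbelianVariety.isSmoothProjective_holds
  haveI := BettiUniverse.finite hP 1
  haveI := BettiUniverse.finite hT 1
  haveI := BettiUniverse.finite hT' 1
  have hZ₂ := hodgeLie_hodge_one_inf_endAlg_eq_bot_of_hasNoTypeIVFactor hT' hB4
  obtain ⟨ψ₁⟩ := BettiUniverse.hodge_isPolarizable exists_isReal_hodgeModel_holds hT 1
  obtain ⟨ψ₂⟩ := BettiUniverse.hodge_isPolarizable exists_isReal_hodgeModel_holds hT' 1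
  obtain ⟨ψ⟩ := BettiUniverse.hodge_isPolarizable exists_isReal_hodgeModel_holds hP 1
  -- the bicone of `H¹(A × B)`
  let ι₁ := BettiUniverse.pullHodgeHom exists_isReal_hodgeModel_holds hodgePQ_independent_of_hodgeModel_holds hP hT (fst A B).hom.hom.hom 1
  let π₁ := BettiUniverse.pullHodgeHom exists_isReal_hodgeModel_holds hodgePQ_independent_of_hodgeModel_holds hT hP
    (prodLift (𝟙 A) (0 : A ⟶ B)).hom.hom.hom 1
  let ι₂ := BettiUniverse.pullHodgeHom exists_isReal_hodgeModel_holds hodgePQ_independent_of_hodgeModel_holds hP hT' (snd A B).hom.hom.hom 1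
  let π₂ := BettiUniverse.pullHodgeHom exists_isReal_hodgeModel_holds hodgePQ_independent_of_hodgeModel_holds hT' hP
    (prodLift (0 : B ⟶ A) (𝟙 B)).hom.hom.hom 1
  have hsumP : fst A B ≫ prodLift (𝟙 A) (0 : A ⟶ B) + snd A B ≫ prodLift (0 : B ⟶ A) (𝟙 B) = 𝟙 _ := by
    refine prod_hom_ext ?_ ?_
    · rw [Preadditive.add_comp, Category.assoc, Category.assoc, prodLift_fst, prodLift_fst, Category.comp_id, comp_zero, add_zero, Category.id_comp]
    · rw [Preadditive.add_comp, Category.assoc, Category.assoc, prodLift_snd, prodLift_snd, Category.comp_id, comp_zero, zero_add, Category.id_comp]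
  have hπι₁ : ∀ v, π₁.toLinearMap (ι₁.toLinearMap v) = v := fun v => pull_pull_eq_self_of_comp_eq_id (prodLift_fst _ _) v
  have hπι₂ : ∀ v, π₂.toLinearMap (ι₂.toLinearMap v) = v := fun v => pull_pull_eq_self_of_comp_eq_id (prodLift_snd _ _) v
  have hsum : ∀ v, ι₁.toLinearMap (π₁.toLinearMap v) + ι₂.toLinearMap (π₂.toLinearMap v) = v := fun v =>
    pull_pull_add_pull_pull_eq_self _ _ _ _ hsumP v
  exact rigid_of_rigid_of_center_eq_bot ι₁ π₁ ι₂ π₂ hπι₁ hπι₂ hsum ψ ⟨ψ₁⟩ ⟨ψ₂⟩ hrigA hZ₂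

/-- **`t(X) ≥ t(A × B)` for `X ∼ (A × B) × Y`**, `H¹(A)` `Θ`-rigid, `B` without factors of type IV (any `Y`).
[cite: MoonenZarhin1999LowDim, §3 (3.1)] -/
theorem mtRank_hodge_one_le_of_isIsogenous_rigid_prod_noTypeIV_prod (hX : IsSmoothProjective n X.X) {A B Y : AbelianVariety ℂ} {m m₁ : ℕ}
    (hP : IsSmoothProjective m (A.prod B).X) (hT : IsSmoothProjective m₁ A.X) (h0 : 0 < A.dim)
    (hrigA : haveI := BettiUniverse.finite hT 1
      ∀ 𝔟 : Submodule ℚ (Module.End ℚ (bettiCohomology A.X 1)),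
        𝔟 ≤ (BettiUniverse.hodge exists_isReal_hodgeModel_holds hT 1).hodgeLie →
        (∀ X' ∈ 𝔟, ∀ Y ∈ 𝔟, X' * Y - Y * X' ∈ 𝔟) →
        (∃ Θ ∈ Submodule.span ℂ ((fun X' : Module.End ℚ (bettiCohomology A.X 1) => X'.baseChange ℂ) ''
            (𝔟 : Set (Module.End ℚ (bettiCohomology A.X 1)))),
          ∀ p, ∀ x ∈ (BettiUniverse.hodge exists_isReal_hodgeModel_holds hT 1).piece p (((1 : ℕ) : ℤ) - p),
            Θ x = ((2 * p - ((1 : ℕ) : ℤ) : ℤ) : ℂ) • x) →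
        (BettiUniverse.hodge exists_isReal_hodgeModel_holds hT 1).hodgeLie ≤ 𝔟)
    (hB4 : HasNoTypeIVFactor B) (hXP : IsIsogenous X ((A.prod B).prod Y)) :
    haveI := BettiUniverse.finite hX 1
    haveI := BettiUniverse.finite hP 1
    (BettiUniverse.hodge exists_isReal_hodgeModel_holds hP 1).mtRank ≤ (BettiUniverse.hodge exists_isReal_hodgeModel_holds hX 1).mtRank :=
  mtRank_hodge_one_le_of_isIsogenous_prod_of_rigid hX hP (by rw [dim_prod]; omega)
    (hodgeLie_rigid_prod_of_rigid_of_hasNoTypeIVFactor hP hT hrigA hB4) hXP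

end Summit.HodgeConjecture.CorCM

end
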